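import Mathlib
import HarnessLib

/-!
# Crux `PoloidalLiouville` (stmt-NavierStokesRegularity-1222, wall W1), crux idea «steady-centre-sieve» (ns-idea-15):
# JET CALCULUS — derivatives of the diagonal Taylor terms of a `C^ω` germ

Support file (`--supports stmt-NavierStokesRegularity-1222`, helper; cell `ns-wall-extremal`, width hand ns-wall-eng-7 g6,
0 kit).  General bookkeeping about the DIAGONAL TAYLOR TERMS `D̃ₙf(y) := iteratedFDeriv ℝ n f x₀ (y, …, y)` of a germ that is
`C^ω` at `x₀` (ns-wall-eng-5 g6's `AnalyticOrder` layer works with the same objects), replacing the «Taylor–Leibniz / lowest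
homogeneous component of products and brackets» layer (β)/(γ) of ns-wall-eng-3 g3's L1 checkpoint by ONE identity:

* `fderiv_diag_of_symmetric` — for a SYMMETRIC continuous `(k+1)`-linear map `M`, the derivative of the diagonal
  `y ↦ M(y,…,y)` in direction `e` is `(k+1) · M(y,…,y,e)`;
* `fderiv_diag_succ` — **jet–derivative exchange**: `∂ₑ (D̃ₖ₊₁ f)(y) = (k+1) · D̃ₖ (∂ₑ f)(y)` for `f` of class `C^ω` at `x₀`
  (symmetry of `iteratedFDeriv` of `C^ω` germs, Mathlib `ContDiffAt.iteratedFDeriv_comp_perm`, + `iteratedFDeriv_succ_apply_right`);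
* consequences: `fderiv_diag_succ_fderiv` (second derivatives), `diag_clm_apply` (`D̃` commutes with continuous linear maps),
  `laplacian_diag` — `Δ (D̃ₖ₊₂ f) = (k+2)(k+1) · D̃ₖ (Δ f)` on a real inner product space,
  `divergence`-type sums via `diag_sum`;
* `exists_bound_of_homogeneous` — a continuous `k`-homogeneous map on a finite-dimensional space is `O(‖y‖ᵏ)` globally.

HONEST FRAME: infrastructure (calculus); closes no crux or sketch Prop; `PoloidalLiouville` (1222) and NS regularity OPEN.
-/

-- the summit and its single sub-problem share the name (CONVENTIONS §1)
set_option linter.dupNamespace false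

noncomputable section

namespace Summit.NavierStokesRegularity.NavierStokesRegularity.Theorems.PoloidalLiouville.JetCalculus

open Set Function Filter Topology
open scoped ContDiff

variable {E F G : Type*} [NormedAddCommGroup E] [NormedSpace ℝ E] [NormedAddCommGroup F] [NormedSpace ℝ F]
  [NormedAddCommGroup G] [NormedSpace ℝ G]

/-! ### The derivative of the diagonal of a symmetric multilinear map -/

omit [NormedAddCommGroup E] [NormedSpace ℝ E] in
/-- `snoc (const y) e` precomposed with the transposition `(i last)` is `update (const y) i e`. -/
theorem snoc_const_comp_swap {k : ℕ} (y e : E) (i : Fin (k + 1)) :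
    (Fin.snoc (fun _ : Fin k => y) e : Fin (k + 1) → E) ∘ (Equiv.swap i (Fin.last k)) =
      Function.update (fun _ => y) i e := by
  classical
  funext j
  simp only [comp_apply]
  by_cases hj : j = i
  · subst hj
    rw [Function.update_self, Equiv.swap_apply_left, Fin.snoc_last]
  · rw [Function.update_of_ne hj]
    by_cases hjl : j = Fin.last k
    · subst hjl
      rw [Equiv.swap_apply_right]
      have hi : i ≠ Fin.last k := fun h => hj h.symm
      obtain ⟨i', rfl⟩ := Fin.exists_castSucc_eq.mpr hi
      rw [Fin.snoc_castSucc]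
    · rw [Equiv.swap_apply_of_ne_of_ne hj hjl]
      obtain ⟨j', rfl⟩ := Fin.exists_castSucc_eq.mpr hjl
      rw [Fin.snoc_castSucc]

/-- **Derivative of the diagonal of a SYMMETRIC multilinear map**: for `M` continuous `(k+1)`-linear with
`M (v ∘ σ) = M v` for all permutations `σ`, `∂ₑ [M(y,…,y)] = (k+1) · M(y,…,y,e)`. -/
theorem fderiv_diag_of_symmetric {k : ℕ} (M : ContinuousMultilinearMap ℝ (fun _ : Fin (k + 1) => E) F)
    (hM : ∀ (v : Fin (k + 1) → E) (σ : Equiv.Perm (Fin (k + 1))), M (v ∘ σ) = M v) (y e : E) :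
    fderiv ℝ (fun y : E => M (fun _ => y)) y e = ((k : ℝ) + 1) • M (Fin.snoc (fun _ : Fin k => y) e) := by
  classical
  have hd : HasFDerivAt (fun y : E => (fun _ : Fin (k + 1) => y))
      (ContinuousLinearMap.pi fun _ : Fin (k + 1) => ContinuousLinearMap.id ℝ E) y :=
    (ContinuousLinearMap.pi fun _ : Fin (k + 1) => ContinuousLinearMap.id ℝ E).hasFDerivAt
  have h : HasFDerivAt (fun y : E => M (fun _ => y))
      ((M.linearDeriv fun _ => y).comp (ContinuousLinearMap.pi fun _ : Fin (k + 1) => ContinuousLinearMap.id ℝ E)) y :=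
    (M.hasFDerivAt (fun _ => y)).comp y hd
  rw [h.fderiv, ContinuousLinearMap.comp_apply]
  simp only [ContinuousLinearMap.pi_apply, ContinuousLinearMap.coe_id', id_eq,
    ContinuousMultilinearMap.linearDeriv_apply]
  have hterm : ∀ i : Fin (k + 1), M (Function.update (fun _ => y) i e) = M (Fin.snoc (fun _ => y) e) := fun i => by
    rw [← snoc_const_comp_swap y e i, hM]
  simp only [hterm, Finset.sum_const, Finset.card_univ, Fintype.card_fin]
  rw [← Nat.cast_smul_eq_nsmul ℝ, Nat.cast_add, Nat.cast_one]

/-! ### Jet–derivative exchange -/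

/-- For `f` of class `C^ω` at `x₀`, the diagonal of `D̃ₖ (fderiv f)` evaluated at `e` is the diagonal of `D̃ₖ (∂ₑ f)`. -/
theorem diag_fderiv_apply {f : E → F} {x₀ : E} (hf : ContDiffAt ℝ ω f x₀) (k : ℕ) (y e : E) :
    iteratedFDeriv ℝ k (fun z => fderiv ℝ f z) x₀ (fun _ => y) e =
      iteratedFDeriv ℝ k (fun z => fderiv ℝ f z e) x₀ (fun _ => y) := by
  have hfd : ContDiffAt ℝ k (fun z => fderiv ℝ f z) x₀ := hf.fderiv_right le_top
  have hcomp : (fun z => fderiv ℝ f z e) = (ContinuousLinearMap.apply ℝ F e) ∘ (fun z => fderiv ℝ f z) := rfl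
  rw [hcomp, (ContinuousLinearMap.apply ℝ F e).iteratedFDeriv_comp_left hfd le_rfl]
  rfl

/-- **Jet–derivative exchange.**  For `f` of class `C^ω` at `x₀` and every `k`, `y`, `e`:
`∂ₑ [y ↦ Dᵏ⁺¹f(x₀)(y,…,y)] (y) = (k+1) · Dᵏ(∂ₑ f)(x₀)(y,…,y)`. -/
theorem fderiv_diag_succ {f : E → F} {x₀ : E} (hf : ContDiffAt ℝ ω f x₀) (k : ℕ) (y e : E) :
    fderiv ℝ (fun y : E => iteratedFDeriv ℝ (k + 1) f x₀ (fun _ => y)) y e =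
      ((k : ℝ) + 1) • iteratedFDeriv ℝ k (fun z => fderiv ℝ f z e) x₀ (fun _ => y) := by
  rw [fderiv_diag_of_symmetric _ (fun v σ => hf.iteratedFDeriv_comp_perm v σ)]
  congr 1
  rw [iteratedFDeriv_succ_apply_right, Fin.init_snoc, Fin.snoc_last]
  exact diag_fderiv_apply hf k y e

/-- The diagonal terms are smooth in `y` (ns-wall-eng-5 g6's `AnalyticOrder.contDiff_diag`, restated to keep this file
self-contained). -/
theorem contDiff_diag {f : E → F} {x₀ : E} (n : ℕ) {m : WithTop ℕ∞} :
    ContDiff ℝ m (fun y : E => iteratedFDeriv ℝ n f x₀ (fun _ => y)) :=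
  (iteratedFDeriv ℝ n f x₀).contDiff.comp (contDiff_pi.mpr fun _ => contDiff_id)

/-- The diagonal terms are differentiable in `y`. -/
theorem differentiable_diag {f : E → F} {x₀ : E} (n : ℕ) :
    Differentiable ℝ (fun y : E => iteratedFDeriv ℝ n f x₀ (fun _ => y)) :=
  (contDiff_diag (m := 1) n).differentiable one_ne_zero

/-- `∂ₑ` of a function, as used below, is again `C^ω` at `x₀`. -/
theorem contDiffAt_fderiv_apply {f : E → F} {x₀ : E} (hf : ContDiffAt ℝ ω f x₀) (e : E) :
    ContDiffAt ℝ ω (fun z => fderiv ℝ f z e) x₀ :=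
  (hf.fderiv_right le_rfl).clm_apply contDiffAt_const

/-- **Second derivatives of the diagonal terms**:
`∂ₑ' ∂ₑ [D̃ₖ₊₂ f] (y) = (k+2)(k+1) · D̃ₖ(∂ₑ' ∂ₑ f)(y)`. -/
theorem fderiv_fderiv_diag {f : E → F} {x₀ : E} (hf : ContDiffAt ℝ ω f x₀) (k : ℕ) (y e e' : E) :
    fderiv ℝ (fun y : E => fderiv ℝ (fun y : E => iteratedFDeriv ℝ (k + 2) f x₀ (fun _ => y)) y e) y e' =
      (((k : ℝ) + 2) * ((k : ℝ) + 1)) •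
        iteratedFDeriv ℝ k (fun z => fderiv ℝ (fun z => fderiv ℝ f z e) z e') x₀ (fun _ => y) := by
  have h1 : (fun y : E => fderiv ℝ (fun y : E => iteratedFDeriv ℝ (k + 2) f x₀ (fun _ => y)) y e) =
      fun y => (((k + 1 : ℕ) : ℝ) + 1) • iteratedFDeriv ℝ (k + 1) (fun z => fderiv ℝ f z e) x₀ (fun _ => y) := by
    funext y
    exact fderiv_diag_succ hf (k + 1) y e
  have h2 : HasFDerivAt
      (fun y : E => (((k + 1 : ℕ) : ℝ) + 1) • iteratedFDeriv ℝ (k + 1) (fun z => fderiv ℝ f z e) x₀ (fun _ => y))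
      ((((k + 1 : ℕ) : ℝ) + 1) •
        fderiv ℝ (fun y : E => iteratedFDeriv ℝ (k + 1) (fun z => fderiv ℝ f z e) x₀ (fun _ => y)) y) y :=
    (differentiable_diag (k + 1) y).hasFDerivAt.const_smul _
  rw [h1, h2.fderiv]
  change (((k + 1 : ℕ) : ℝ) + 1) •
      fderiv ℝ (fun y : E => iteratedFDeriv ℝ (k + 1) (fun z => fderiv ℝ f z e) x₀ (fun _ => y)) y e' = _
  rw [fderiv_diag_succ (contDiffAt_fderiv_apply hf e) k y e', smul_smul]
  congr 1
  push_cast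
  ring

/-- `iteratedFDeriv ℝ 2` of the diagonal term along `(e, e)`: `(k+2)(k+1) · D̃ₖ (D²f(·)(e,e))`. -/
theorem iteratedFDeriv_two_diag {f : E → F} {x₀ : E} (hf : ContDiffAt ℝ ω f x₀) (k : ℕ) (y e : E) :
    iteratedFDeriv ℝ 2 (fun y : E => iteratedFDeriv ℝ (k + 2) f x₀ (fun _ => y)) y ![e, e] =
      (((k : ℝ) + 2) * ((k : ℝ) + 1)) •
        iteratedFDeriv ℝ k (fun z => iteratedFDeriv ℝ 2 f z ![e, e]) x₀ (fun _ => y) := by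
  rw [iteratedFDeriv_two_apply]
  simp only [Matrix.cons_val_zero, Matrix.cons_val_one]
  -- `fderiv (fderiv P) y e e = fderiv (fun y => fderiv P y e) y e`
  have hP : ContDiff ℝ 2 (fun y : E => iteratedFDeriv ℝ (k + 2) f x₀ (fun _ => y)) := contDiff_diag (k + 2)
  have hdP : DifferentiableAt ℝ (fderiv ℝ (fun y : E => iteratedFDeriv ℝ (k + 2) f x₀ (fun _ => y))) y :=
    ((hP.fderiv_right (m := 1) (by norm_num)).differentiable one_ne_zero).differentiableAt
  have h2 : fderiv ℝ (fun y : E => fderiv ℝ (fun y : E => iteratedFDeriv ℝ (k + 2) f x₀ (fun _ => y)) y e) y e =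
      fderiv ℝ (fderiv ℝ (fun y : E => iteratedFDeriv ℝ (k + 2) f x₀ (fun _ => y))) y e e := by
    rw [fderiv_clm_apply hdP (differentiableAt_const e)]
    simp
  rw [← h2, fderiv_fderiv_diag hf k y e e]
  congr 1
  have h3 : (fun z => fderiv ℝ (fun z => fderiv ℝ f z e) z e) =ᶠ[𝓝 x₀] fun z => iteratedFDeriv ℝ 2 f z ![e, e] := by
    -- near `x₀`, `f` is `C^ω`, in particular `C²`, so the two expressions agree
    have hev : ∀ᶠ z in 𝓝 x₀, ContDiffAt ℝ 2 f z := (hf.of_le le_top).eventually (by simp)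
    filter_upwards [hev] with z hz
    rw [iteratedFDeriv_two_apply]
    simp only [Matrix.cons_val_zero, Matrix.cons_val_one]
    have hd2 : DifferentiableAt ℝ (fderiv ℝ f) z :=
      (hz.fderiv_right (m := 1) (by norm_num)).differentiableAt one_ne_zero
    rw [fderiv_clm_apply hd2 (differentiableAt_const e)]
    simp
  rw [(h3.iteratedFDeriv ℝ k).eq_of_nhds]

/-! ### Diagonal terms and linear operations -/

/-- `D̃ₙ (l ∘ f) = l ∘ D̃ₙ f` for a continuous linear `l`. -/
theorem diag_clm_apply {f : E → F} {x₀ : E} (l : F →L[ℝ] G) {n : ℕ} (hf : ContDiffAt ℝ n f x₀) (y : E) :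
    iteratedFDeriv ℝ n (fun z => l (f z)) x₀ (fun _ => y) = l (iteratedFDeriv ℝ n f x₀ (fun _ => y)) := by
  have hcomp : (fun z => l (f z)) = l ∘ f := rfl
  rw [hcomp, l.iteratedFDeriv_comp_left hf le_rfl]
  rfl

/-- `D̃ₙ (Σⱼ fⱼ) = Σⱼ D̃ₙ fⱼ`. -/
theorem diag_sum {ι : Type*} (s : Finset ι) {f : ι → E → F} {x₀ : E} {n : ℕ}
    (hf : ∀ j ∈ s, ContDiffAt ℝ n (f j) x₀) (y : E) :
    iteratedFDeriv ℝ n (fun z => ∑ j ∈ s, f j z) x₀ (fun _ => y) =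
      ∑ j ∈ s, iteratedFDeriv ℝ n (f j) x₀ (fun _ => y) := by
  rw [iteratedFDeriv_fun_sum_apply hf]
  simp

/-- Germs that agree near `x₀` have the same diagonal terms. -/
theorem diag_congr {f g : E → F} {x₀ : E} (h : f =ᶠ[𝓝 x₀] g) (n : ℕ) (y : E) :
    iteratedFDeriv ℝ n f x₀ (fun _ => y) = iteratedFDeriv ℝ n g x₀ (fun _ => y) := by
  rw [(h.iteratedFDeriv ℝ n).eq_of_nhds]

/-- A germ that vanishes near `x₀` has vanishing diagonal terms. -/
theorem diag_eq_zero_of_eventuallyEq_zero {f : E → F} {x₀ : E} (h : f =ᶠ[𝓝 x₀] 0) (n : ℕ) (y : E) :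
    iteratedFDeriv ℝ n f x₀ (fun _ => y) = 0 := by
  rw [(h.iteratedFDeriv ℝ n).eq_of_nhds]
  simp


/-! ### Homogeneity of the diagonal terms and of their derivatives -/

/-- `D̃ₙf(c y) = cⁿ D̃ₙf(y)` (ns-wall-eng-5 g6's `AnalyticOrder.diag_smul`, restated for self-containedness). -/
theorem diag_smul {f : E → F} {x₀ : E} (n : ℕ) (c : ℝ) (y : E) :
    iteratedFDeriv ℝ n f x₀ (fun _ => c • y) = c ^ n • iteratedFDeriv ℝ n f x₀ (fun _ => y) := by
  have h := (iteratedFDeriv ℝ n f x₀).map_smul_univ (fun _ : Fin n => c) (fun _ => y)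
  simpa using h

/-- The derivative of `D̃ₖ₊₁ f` is homogeneous of degree `k`: `∂ₑ(D̃ₖ₊₁f)(c y) = cᵏ ∂ₑ(D̃ₖ₊₁f)(y)`. -/
theorem fderiv_diag_succ_smul {f : E → F} {x₀ : E} (hf : ContDiffAt ℝ ω f x₀) (k : ℕ) (c : ℝ) (y e : E) :
    fderiv ℝ (fun y : E => iteratedFDeriv ℝ (k + 1) f x₀ (fun _ => y)) (c • y) e =
      c ^ k • fderiv ℝ (fun y : E => iteratedFDeriv ℝ (k + 1) f x₀ (fun _ => y)) y e := by
  rw [fderiv_diag_succ hf, fderiv_diag_succ hf, diag_smul, smul_comm]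

/-- Operator-norm bound for the derivative of a diagonal term:
`‖∂(D̃ₖ₊₁ f)(y)‖ ≤ (k+1) ‖Dᵏ(Df)(x₀)‖ ‖y‖ᵏ`. -/
theorem norm_fderiv_diag_succ_le {f : E → F} {x₀ : E} (hf : ContDiffAt ℝ ω f x₀) (k : ℕ) (y : E) :
    ‖fderiv ℝ (fun y : E => iteratedFDeriv ℝ (k + 1) f x₀ (fun _ => y)) y‖ ≤
      ((k : ℝ) + 1) * ‖iteratedFDeriv ℝ k (fun z => fderiv ℝ f z) x₀‖ * ‖y‖ ^ k := by
  refine ContinuousLinearMap.opNorm_le_bound _ (by positivity) fun e => ?_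
  rw [fderiv_diag_succ hf, ← diag_fderiv_apply hf, norm_smul, Real.norm_of_nonneg (by positivity)]
  have h1 : ‖iteratedFDeriv ℝ k (fun z => fderiv ℝ f z) x₀ (fun _ => y) e‖ ≤
      ‖iteratedFDeriv ℝ k (fun z => fderiv ℝ f z) x₀ (fun _ => y)‖ * ‖e‖ := ContinuousLinearMap.le_opNorm _ _
  have h2 : ‖iteratedFDeriv ℝ k (fun z => fderiv ℝ f z) x₀ (fun _ => y)‖ ≤
      ‖iteratedFDeriv ℝ k (fun z => fderiv ℝ f z) x₀‖ * ∏ _i : Fin k, ‖y‖ :=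
    ContinuousMultilinearMap.le_opNorm _ _
  rw [Finset.prod_const, Finset.card_univ, Fintype.card_fin] at h2
  calc ((k : ℝ) + 1) * ‖iteratedFDeriv ℝ k (fun z => fderiv ℝ f z) x₀ (fun _ => y) e‖
      ≤ ((k : ℝ) + 1) * (‖iteratedFDeriv ℝ k (fun z => fderiv ℝ f z) x₀‖ * ‖y‖ ^ k * ‖e‖) := by
        gcongr
        calc _ ≤ _ := h1
          _ ≤ _ := by gcongr
    _ = ((k : ℝ) + 1) * ‖iteratedFDeriv ℝ k (fun z => fderiv ℝ f z) x₀‖ * ‖y‖ ^ k * ‖e‖ := by ring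

/-- Norm bound for a diagonal term: `‖D̃ₙ f(y)‖ ≤ ‖Dⁿf(x₀)‖ ‖y‖ⁿ`. -/
theorem norm_diag_le {f : E → F} {x₀ : E} (n : ℕ) (y : E) :
    ‖iteratedFDeriv ℝ n f x₀ (fun _ => y)‖ ≤ ‖iteratedFDeriv ℝ n f x₀‖ * ‖y‖ ^ n := by
  have h := (iteratedFDeriv ℝ n f x₀).le_opNorm (fun _ => y)
  rw [Finset.prod_const, Finset.card_univ, Fintype.card_fin] at h
  exact h

/-! ### The Laplacian of a diagonal term -/

section Laplacian

variable {E' : Type*} [NormedAddCommGroup E'] [InnerProductSpace ℝ E'] [FiniteDimensional ℝ E']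

open InnerProductSpace in
/-- **Laplacian of a diagonal term**: `Δ (D̃ₖ₊₂ f)(y) = (k+2)(k+1) · D̃ₖ (Δ f)(y)` for `f` of class `C^ω` at `x₀`. -/
theorem laplacian_diag {f : E' → F} {x₀ : E'} (hf : ContDiffAt ℝ ω f x₀) (k : ℕ) (y : E') :
    Laplacian.laplacian (fun y : E' => iteratedFDeriv ℝ (k + 2) f x₀ (fun _ => y)) y =
      (((k : ℝ) + 2) * ((k : ℝ) + 1)) • iteratedFDeriv ℝ k (Laplacian.laplacian f) x₀ (fun _ => y) := by
  rw [laplacian_eq_iteratedFDeriv_stdOrthonormalBasis, laplacian_eq_iteratedFDeriv_stdOrthonormalBasis]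
  simp only [iteratedFDeriv_two_diag hf]
  rw [← Finset.smul_sum]
  congr 1
  have hterms : ∀ i, ContDiffAt ℝ k (fun z => iteratedFDeriv ℝ 2 f z ![stdOrthonormalBasis ℝ E' i,
      stdOrthonormalBasis ℝ E' i]) x₀ := fun i => by
    have h2 : ContDiffAt ℝ k (iteratedFDeriv ℝ 2 f) x₀ := hf.iteratedFDeriv_right le_top
    exact (ContinuousMultilinearMap.apply ℝ (fun _ : Fin 2 => E') F
      ![stdOrthonormalBasis ℝ E' i, stdOrthonormalBasis ℝ E' i]).contDiff.contDiffAt.comp x₀ h2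
  rw [diag_sum Finset.univ (fun i _ => hterms i)]

end Laplacian

/-! ### Continuous homogeneous maps on a finite-dimensional space are `O(‖y‖ᵏ)` -/

/-- A continuous `k`-homogeneous map on a finite-dimensional space is bounded by `C ‖y‖ᵏ` everywhere. -/
theorem exists_bound_of_homogeneous [FiniteDimensional ℝ E] {P : E → F} {k : ℕ} (hP : Continuous P)
    (hhom : ∀ (c : ℝ) (y : E), P (c • y) = c ^ k • P y) : ∃ C : ℝ, ∀ y : E, ‖P y‖ ≤ C * ‖y‖ ^ k := by
  -- bound on the unit sphere (compact), then scale
  obtain ⟨C, hC⟩ : ∃ C : ℝ, ∀ y ∈ Metric.sphere (0 : E) 1, ‖P y‖ ≤ C := by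
    have hcpt : IsCompact (Metric.sphere (0 : E) 1) := isCompact_sphere 0 1
    obtain ⟨C, hC⟩ := hcpt.exists_bound_of_continuousOn hP.continuousOn
    exact ⟨C, hC⟩
  have hC0 : 0 ≤ C ∨ ∀ y : E, y = 0 := by
    by_cases h : ∃ y : E, y ≠ 0
    · obtain ⟨y, hy⟩ := h
      left
      have hu : ‖y‖⁻¹ • y ∈ Metric.sphere (0 : E) 1 := by
        rw [mem_sphere_zero_iff_norm, norm_smul, norm_inv, norm_norm, inv_mul_cancel₀ (norm_ne_zero_iff.mpr hy)]
      exact (norm_nonneg _).trans (hC _ hu)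
    · right; intro y; by_contra hy; exact h ⟨y, hy⟩
  refine ⟨max C ‖P 0‖, fun y => ?_⟩
  by_cases hy : y = 0
  · subst hy
    rcases Nat.eq_zero_or_pos k with hk | hk
    · subst hk; simp
    · have h0 : P 0 = 0 := by
        have := hhom 0 0
        rw [smul_zero, zero_pow hk.ne', zero_smul] at this
        -- `P (0 • 0) = P 0`
        simpa using this
      rw [h0, norm_zero]
      positivity
  · have hn : ‖y‖ ≠ 0 := norm_ne_zero_iff.mpr hy
    have hu : ‖y‖⁻¹ • y ∈ Metric.sphere (0 : E) 1 := by
      rw [mem_sphere_zero_iff_norm, norm_smul, norm_inv, norm_norm, inv_mul_cancel₀ hn]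
    have hPy : P y = ‖y‖ ^ k • P (‖y‖⁻¹ • y) := by
      have := hhom ‖y‖ (‖y‖⁻¹ • y)
      rw [smul_smul, mul_inv_cancel₀ hn, one_smul] at this
      exact this
    rw [hPy, norm_smul, norm_pow, norm_norm, mul_comm]
    gcongr
    exact (hC _ hu).trans (le_max_left _ _)

end Summit.NavierStokesRegularity.NavierStokesRegularity.Theorems.PoloidalLiouville.JetCalculus

end
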